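import Mathlib
import HarnessLib
import HarnessLib.Audit
import Summits.HodgeConjecture.Statement
import Literature.AlgebraicGeometry.HodgeTheory.WeilClassesBFSheafSeed
import Literature.AlgebraicGeometry.HodgeTheory.WeilFamilyHodgeSectionAll
import Literature.AlgebraicGeometry.Motives.CrystallineRealization
import Summits.HodgeConjecture.HodgeConjecture.Theses.SevenfoldWeilCensus
import Summits.HodgeConjecture.HodgeConjecture.Theorems.Ring2SemiregularRepresentativesVHC
import Summits.HodgeConjecture.HodgeConjecture.Theorems.WeilTypeLadderTensorLocalAnchorAll
import HarnessLib.Audit.Status.Attr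

/-!
Route: TensorMonadSeeds

CLOSED (retired) 2026-08-28T12:06:36Z by planner-hodge-idea-3-g2-0 — reason: exhausted per director R13.65 (KILL-1 supported not certified; cscan VERDICT-TMS-nearband.md 769b5281…); closed by the opener seat's successor generation hodge-idea-3 g2 — note: exhausted (director R13.65 ruling 11:47:04Z on R13.51/PREREG-2; critic idea-crit-6 g3 READ #5 concur; cscan verdict VERDICT-TMS-nearband.md sha256 769b5281…, evidence #13 on stmt-26403 and on 26402, refuter-hodge-tms-cscan-1-g0-0, kit j302862 (cancelled: HiGHS MILP never honoured time_limit, disclos. The file is kept as the record of this route; refuted decls are indexed as negative knowledge (`ledger negatives`).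

# Route TensorMonadSeeds — linear-monad bundles as Buchweitz–Flenner I-semiregular seeds at the
tensor points of the Weil sixfold families, close rung H2

LINE g0-2 of ideator hodge-idea-3 (technique card «splitting / non-equivalent criterion search»),
bearing on rung H2 =
`SevenfoldWeilCensus.WeilSixfolds` (stmt-HodgeConjecture-2524: every rational (3,3) Weil class on
every √−d-Weil abelian sixfold, every d,
split and non-split discriminant). It suffices to show X = K1 ∧ K2 at the TENSOR POINTS Y ~ A₁ × A₁
(A₁ an abelian threefold) of Deligne's
six-dimensional √−d families: (K1, MONAD CLASS DESIGNS) every non-zero rational Weil class x there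
is, modulo rational multiples of powers of a
hyperplane class h, the third Chern character of the cohomology bundle E₀ of a LINEAR MONAD of line
bundles ⊕L → ⊕M → ⊕N (first map a
monomorphism, second an epimorphism), with ch₁, ch₂, ch₄, ch₅ of E₀ pure powers of h; (K2, MONAD ⇒
SEMIREGULAR SEED) where such a class-exact
monad exists, a class-exact finite locally free seed exists which is I-semiregular for I = {1,…,5}
(Buchweitz–Flenner: σ_I : Ext²(E₀,E₀) → ⊕_{p∈I} H^{p+1}(Ω^{p−1})
injective). This is exactly the tree's unrouted door II′ `HasTensorBFSheafSeeds C 3 d {1,…,5}` with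
the seed OBJECT named; the PROVED bridge
`hasLocallyAlgebraicTensorAnchors_of_BF_of_tensorBFSheafSeeds` (Buchweitz–Flenner Thm 5.1 as the
refereed named fact) and the PROVED ladder theorem
`weilSixfolds_of_deligneAll_of_tensorLocalAnchors` (Deligne's all-d family fact) give H2. No summit
and no rung is proved by filing this line.
Lean: `MonadClassDesigns ∧ MonadToSemiregularSeed`

## Assembly
Kernel-checked in the sketch (line3/Sketch3fq.lean, 0 sorry): K2 applied to K1 yields, for every (Y,
Ψ, x, emb, a, X₀, e), an I-semiregular
finite locally free E₀ with the prescribed Chern characters, i.e. `HasTensorBFSheafSeeds C 3 d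
{1,…,5}` for every d > 0 (drop the monad clause);
`hasLocallyAlgebraicTensorAnchors_of_BF_of_tensorBFSheafSeeds` (with BFVariationalHodge) gives
`HasLocallyAlgebraicTensorAnchors 3 d`, and
`WeilTypeLadder.weilSixfolds_of_deligneAll_of_tensorLocalAnchors` (with DeligneWeilFamilies) gives
rung H2. The deciding theorem
`closes hC hBF hD k1 k2` goes through `Assembly`.

CLOSES_TARGET: closes rung H2 of HodgeConjecture: Summit.HodgeConjecture.HodgeConjecture.Theses.SevenfoldWeilCensus.WeilSixfolds (D-0061; not the summit Statement) — the deciding theorem of this route concludes that registered leaf instead of the Statement decl `HodgeConjecture` (class rung: servable and labelled, never counted as concluding the summit Statement).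

Rationale: WHY THIS LINE. The tree's census of semiregular designs for Weil classes (Summits/Ventures/HSemireg,
ONE STATEMENT `WeilNonSplitSemiregularityObstruction`) kills
every design GOVERNED by extra Néron–Severi or by a sub-family (split sums of line bundles,
semi-homogeneous bundles, their Porteous loci: rigidity
excess makes σ non-injective) and every h-free design (Voisin), and records door II′ —
Buchweitz–Flenner I-semiregular SHEAF seeds at the tensor
points, transport refereed (arXiv:math/9912245 Thm 5.1; Bloch1972Semiregularity;
Deligne1982HodgeCycles proof of Thm 4.8) — as OPEN with no design
known; no listed route uses it (FirstOrderSemiregularSeeds goes through first-order 𝒪_C-sheaf seeds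
on EIGHTFOLDS with Markman's Question 11.4 as an
open transfer binder; EightfoldBlochSeeds through Bloch lci subschemes; BiquadraticSecantLift
through Markman's κ-twisted secant sheaves,
arXiv:2502.03415). The object imported here from the theory of vector bundles is the MONAD
(Horrocks, doi:10.1112/plms/s3-14.4.689): the cohomology
bundle of ⊕L → ⊕M → ⊕N is built from line bundles — so at a tensor point, where the Weil classes lie
in the divisor algebra (Deligne), its Chern
character can be DESIGNED by a moment argument — but it is NOT a sum of line bundles, and its
Ext²(E₀,E₀) is computed from H^•(Y, line bundles),
which on abelian varieties is concentrated in the Mumford index (doi:10.1215/kjm/1250522572): the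
off-diagonal extension data is what can make σ_I
injective where split designs fail. The splitting is deliberate: K1 is a class-level
moment/positivity problem in NS(Y)_ℚ with honest sheaves
(the definiteness question the census leaves open), K2 the semiregularity of one realization — a
finite theta-function linear-algebra problem on
E⁶-type tensor points, i.e. an instrument exists. Neither is implied by H2 (algebraicity of Weil
classes says nothing about semiregular monad
bundles), so the criterion is non-equivalent by design.

RANKED CRUXES. #2 MonadToSemiregularSeed (crux) — for every Chern-character theory C, every d > 0,
every tensor point (Y, Ψ) of the six-dimensional √−d Weil family (isogeny pair to A₁ × A₁ with Ψ the
standard matrix), every non-zero rational Weil class x, every projective embedding with hyperplane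
data a and every model e : Y ≅ X₀: IF some class-exact linear monad of line bundles exists on X₀
(cohomology bundle E₀ with e^*ch₃(E₀) = q·h³ + x and e^*ch_p(E₀) = c_p·h^p for p ∈ {1,2,4,5}), THEN
there is a class-exact finite locally free seed E₀′ (same Chern-character conditions) which is
I-semiregular for I = {1,…,5} — the monad is the resource, the semiregular seed the product (it may
be the monad bundle itself or a modification of it). [deps: MonadClassDesigns] [difficulty:
open-problem] (why it might fail: rigidity excess may survive the monad: if Ext²(E₀,E₀) of every
class-exact monad bundle at a tensor point keeps an H²(𝒪)-type block on which σ_I factors through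
contraction with ch(E₀), σ_I is never injective (hsemireg ONE STATEMENT (ii); NEG #12/#15 kill the
Porteous cousins).) [arXiv:math/9912245, doi:10.1215/kjm/1250522572, arXiv:2502.03415,
Bloch1972Semiregularity]
#3 MonadClassDesigns (crux) — same data; there are a finite locally free E₀ on X₀, q ∈ ℚ and c : ℕ →
ℚ with e^*ch₃(E₀) = q·h³ + x and e^*ch_p(E₀) = c_p·h^p for p ∈ {1,2,4,5}, where E₀ is the cohomology
bundle of a linear monad of line bundles: line bundles L_i, M_j, N_l on X₀, a monomorphism α : ⊕L →
⊕M and an epimorphism β : ⊕M → ⊕N with β∘α = 0 and E₀ ≅ coker(⊕L → ker β). [difficulty: L] (why it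
might fail: honest sheaves fix the sign pattern ch(E₀) = Σe^μ − Σe^λ − Σe^ν and need fibrewise
injective/surjective maps between the sums; the moment problem “ch₃ ∋ x, ch₁,₂,₄,₅ ∈ ℚh^p” may force
coefficients or degrees no monad on a sixfold realises (definiteness, census C62a).)
[Deligne1982HodgeCycles, doi:10.1112/plms/s3-14.4.689, doi:10.1215/kjm/1250522572,
arXiv:math/0702048]
#5 ChernCharacterOnBetti (crux) — CONSTRUCTION input (shared by name with VHCAbelianSchemesRoad /
FirstOrderSemiregularSeeds, item `Ring2.SemiregularRepresentatives.ChernCharacterOnBetti`): a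
Chern-character theory on rational Betti cohomology with the tree's axioms exists. Binder of the
deciding theorem; never a new staffing target of this route. [difficulty: L] (why it might fail:
only if the tree's `ChernCharacterBetti` structure over-axiomatises ch (an axiom false for the
genuine Chern character); the genuine construction (GRR on Betti cohomology) is textbook.)
[Fulton1984, VoisinHodgeI2002]
#6 BFVariationalHodge (crux) — REFEREED NAMED FACT — Literature input, never staffed (only crux
items may be binders of the deciding theorem): Buchweitz–Flenner 2003 Thm 5.1 for I-semiregular
sheaves, as typed in the tree (`BuchweitzFlenner2003_variationalHodge_ISemiregular`). [difficulty:
L] (why it might fail: it is a published theorem (Compositio 137 (2003) Thm 5.1); only a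
mis-rendering of its hypotheses in the tree's statement could fail.) [arXiv:math/9912245]
#7 DeligneWeilFamilies (crux) — REFEREED NAMED FACT — Literature input, never staffed: Deligne's √−d
Weil families through every Weil abelian 2k-fold with a flat global section of Weil classes and the
tensor points in every component, every d (`deligne1982_weilFamily_hodgeWeilSection_all`).
[difficulty: L] (why it might fail: it is Deligne 1982 (LNM 900, proof of Thm 4.8 (a)–(c)) for every
d; only a mis-rendering in the tree's statement could fail.) [Deligne1982HodgeCycles]

TWO-LAYER PLAN. K1 ⇐ TensorPointLefschetz (Weil classes at a tensor point lie in the divisor algebra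
— Deligne) → MomentDesign (signed exponential sums with
prescribed ch_{1..5}) → HonestRealization (positivity: the negative part goes to L and N, global
generation gives injective/surjective maps on a
sixfold once the rank margins are ≥ 6). K2 ⇐ OffDiagonalVanishing (Mumford-index bookkeeping:
Ext²(E₀,E₀) reduces to diagonal H²(𝒪)-blocks and
finitely many mixed blocks) → DiagonalAbsorption (the monad differentials map the diagonal blocks
injectively under σ_I) → K2. Nothing filed now.

KILL CRITERIA. If at the explicit tensor point Y = E³ × E³ (E an elliptic curve, Ψ the standard √−d
matrix, d = 7) NO class-exact linear monad with term degrees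
below the Castelnuovo–Mumford-type bound has injective σ_I (a finite computation),
MonadToSemiregularSeed is dead in its first instance — close
`refuted:MonadToSemiregularSeed`; if already the class design is infeasible there (an LP/moment
certificate), close `refuted:MonadClassDesigns`.
A proof of the hsemireg rigidity-excess statement for ALL bundles admitting a filtration by line
bundles at tensor points kills the line outright.
H2 proved elsewhere (FirstOrderSemiregularSeeds, EightfoldBlochSeeds, Markman) moots it.

NOT DECOMPOSED YET. The moment/positivity lemma for honest monads (K1's layer 2), the Mumford-index
reduction of Ext²(E₀,E₀) (K2's layer 2), the transport of
designs along the isogeny pair (f₁, g₁) (designs on A₁ × A₁ itself suffice), and the choice I =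
{1,…,5} versus smaller I (a smaller I makes σ_I
harder to be injective but the class conditions fewer). All layer-2 children once the instrument row
has run.

CHEAPEST FALSIFIER. INSTRUMENT ROW (refutes/calibrates K2, then K1): Y = E³ × E³, E = ℂ/(ℤ + ℤτ)
generic, Ψ = ((0, −d),(1, 0)) ⊗ 1, d = 7 (non-split components exist;
the d = 7 sixfold slice `HeckePrymWeil.WeilSixfoldsSqrtMinus7` is OPEN in the tree): (1) write the
2-dimensional Weil space W ⊂ H⁶(Y, ℚ) in the
divisor algebra (NS(E⁶)_ℚ, rank 21 for generic E); (2) enumerate linear monads ⊕L → ⊕M → ⊕N with c₁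
of all terms of degree ≤ B in NS and solve the
class design as an integer program; (3) for each solution compute Ext²(E₀,E₀) and σ_I by Künneth +
Mumford's index theorem (theta-function linear
algebra, exact over ℚ(τ)-independent combinatorics for generic E); output = max rank of σ_I. B = 3
is one kit job (not run by this seat: no compute
before the critic prices the line). All-B failure up to the regularity bound kills K2 where H2 is
OPEN — informative either way.

NUMBERS. Sixfold tensor point: target of σ_I has dimension Σ_{p=1..5} h^{p−1,p+1}(Y) = 15 + 120 +
225 + 120 + 15 = 495; Weil directions at the tensor point
n² = 9 (n = 3); dim_ℚ W = 2; NS(E⁶)_ℚ rank 21 (generic E), 36 (CM E). Buchweitz–Flenner Thm 5.1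
needs σ_I injective on Ext² only. Items at open:
6 (5 crux-kind of which 2 genuine design cruxes + 1 construction + 2 refereed facts, 1 assembly).

DEFINITION REQUESTS. None. (`HasRank`, `IsFiniteLocallyFree`, `IsISemiregular`,
`ChernCharacterBetti`, `HasTensorBFSheafSeeds` all exist; the monad clause is spelled
with Mathlib's `sigmaObj`/`kernel.lift`/`cokernel` in the abelian category `X₀.left.Modules`.)

Novelty: Searches (2026-08-28 04:10Z): `lit search --hybrid "monad vector bundle abelian variety
semiregularity map injective Chern character Hodge class" -n 8` → 8 books
(Carlson–Müller-Stach–Peters, Voisin I, Kobayashi, Görtz–Wedhorn II …), no monad/semiregular-seed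
hit; `lit vsearch "<K2 in prose>" -k 8` → Green–Murre–Voisin, Kerr–Pearlstein, Cattani–El
Zein–Griffiths …, no hit; `lit search "Buchweitz Flenner semiregularity variational Hodge" -n 8` →
[corpus:paper:arxiv-2502.03415 p.8] (Markman reviews BF for twisted sheaves),
[corpus:paper:arxiv-1612.00754 p.7] (semi-regular varieties and VHC), [corpus:paper:arxiv-2104.14845
p.12] (VHC for c.i. on hypersurfaces), remote doi:10.1023/a:1023999012081 = arXiv:math/9912245 (BF),
doi:10.2140/pjm.2024.328.361 (Nishinou, pairs); `lit galaxy search "semiregularity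
map|semi-regularity map|linear monad" --star all -n 10` → 20 junk rows (CS lecture-note front
matter), no mathematical hit; tree: `rg HasTensorBFSheafSeeds
Summits/HodgeConjecture/HodgeConjecture/Theses Theorems` → no route or theorem consumes door II′;
hsemireg ONE STATEMENT and census C62a read.
Nearest prior art found: arXiv:2502.03415 (Markman: κ-twisted secant sheaves, semiregular in his
twisted sense, route BiquadraticSecantLift); route FirstOrderSemiregularSeeds (first-order 𝒪_C-sheaf
seeds on eightfolds, Markman Q11.4 transfer open); route EightfoldBlochSeeds (Bloch lci seeds);
Literature door `WeilClassesBFSheafSeed` (the predicate itself, no design); arXiv:math/9912245  [refs: 10.1023/a:1023999012081, 10.2140/pjm.2024.328.361, math/9912245, 2502.03415, paper:arxiv-2502.03415, paper:arxiv-1612.00754, paper:arxiv-2104.14845, doi:10.1023/a, doi:10.2140/pjm.2024.328.361]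

Barriers (technique_class: semiregularity variational-hodge monads tensor-point-design): - technique_class: semiregularity variational-hodge monads tensor-point-design
- Literature.Barriers.HodgeConjecture.Andre1996_hodgeClassesOnAbelianVarieties_motivated: outside —
the line never argues from motivatedness/absolute Hodge; it produces algebraic cycles (ch of a
deformed sheaf) along the family by Buchweitz–Flenner and reads algebraicity of the Weil class off
Deligne's flat section.
- Literature.Barriers.HodgeConjecture.CattaniDeligneKaplan1995_hodgeLocus_algebraicFor: consistent
and used only in the direction the tree already proved (the ladder theorem); the new content is an
OBJECT at one point, not a statement about the Hodge locus.
- Literature.Barriers.HodgeConjecture.AtiyahHirzebruch1962_torsionClass_notAlgebraic and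
Literature.Barriers.HodgeConjecture.Kollar1992_nonTorsionClass_notAlgebraic: not applicable —
rational classes on abelian varieties, rational multiples allowed (q, c_p ∈ ℚ).
- Literature.Barriers.HodgeConjecture.Charles2009_conjugateVarieties_cohomologyAlgebrasNotIso:
outside — everything happens inside one connected algebraic family over ℂ with a flat section; no
conjugation argument.
- hsemireg ONE STATEMENT (Summits/Ventures/HSemireg/WeilNonSplitSemiregularityObstruction:
`not_injective_of_obstruction`, `necessary_of_injective`): (i) Voisin h-free prong n/a (E₀ carries W
in ch₃); (ii) rigidity excess is the live risk and is MET, not evaded: a monad bundle is not a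
priori governed by the tensor point's extra NS, and the necessary KS-condition ⟨

History (route lifecycle, newest last):
- 2026-08-28T07:01:11Z · rev 1: restated MonadClassDesigns (stmt-HodgeConjecture-25634), MonadToSemiregularSeed (stmt-HodgeConjecture-25633), Assembly (stmt-HodgeConjecture-25637) — OWNER REPAIR (misstated, self-found): K1/K2 exact-x quantifier -> integer multiple N x (ch_3 of a locally free sheaf is in (1/6)H^6(Y,Z), the exact-x door II' i (planner-hodge-idea-3-g0-0)
- 2026-08-28T12:06:36Z · CLOSED retired — exhausted per director R13.65 (KILL-1 supported not certified; cscan VERDICT-TMS-nearband.md 769b5281…); closed by the opener seat's successor generation hodge-idea-3 g2 (planner-hodge-idea-3-g2-0)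

sub-problem: HodgeConjecture · status: closed(retired) · opened planner-hodge-idea-3-g0-0 2026-08-28T04:16:59Z · rev 1 · ledger route-HodgeConjecture-TensorMonadSeeds
GENERATED by the gate from the ledger (D-0016/17). Provers cite these decls: `theorem foo : Summit.HodgeConjecture.HodgeConjecture.Theses.TensorMonadSeeds.<Decl> := …` in Summits/HodgeConjecture/HodgeConjecture/Theorems/<Name>.lean.
-/

namespace Summit.HodgeConjecture.HodgeConjecture.Theses.TensorMonadSeeds

open scoped BigOperators Topology Manifold Classical MeasureTheory ProbabilityTheory Matrix InnerProductSpace ComplexConjugate ContinuousMap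
open Filter Set Function TopologicalSpace MeasureTheory

attribute [summit_statement] _root_.HodgeConjecture
attribute [summit_statement] _root_.Summit.HodgeConjecture.HodgeConjecture.Theses.SevenfoldWeilCensus.WeilSixfolds

-- earlier MonadToSemiregularSeed (stmt-HodgeConjecture-25633, replaced 2026-08-28T07:01:11Z -> stmt-HodgeConjecture-26403): retired by None — ∀ (C : Literature.AlgebraicGeometry.HodgeTheory.ChernCharacterBetti) (d : ℕ), 0 < d → ∀ (Y : Literature.AlgebraicGeometry.Motives.AbelianVariety ℂ) (Ψ : Y ⟶ Y), Y.dim = 2 * 3 → CategoryTheory.CategoryStruct.comp Ψ Ψ = -((d : ℤ) • CategoryTheory.CategoryStruct.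
/-- item stmt-HodgeConjecture-26403 · crux · rank 2 · closed · moot by None · by planner
why it might fail: far-band monads are never semiregular (RR/Serre: dim Ext² ≥ χ(E,E)/2 − dim End ≫ 495) and σ on the diagonal Ext² saturates at rank ≤ 189/255, so a witness must be a near-band design with ≤ 12–15 distinct classes and injective off-diagonal σ — none found yet (CSCAN-SPEC-TMS-nearband.md)
sources: BuchweitzFlenner2003:S5, Perry2026Semiregularity:Def2.4, INSTRUMENT-RESULTS-TMS-i.md, CSCAN-SPEC-TMS-nearband.md
[crux, REPAIRED 2026-08-28 by the route owner] K2 monad => I-semiregular seed UP TO A POSITIVE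
INTEGER MULTIPLE: at every tensor point, from the K1 designs (for some N>0) produce a finite locally
free E0, {0..4}-semiregular in the tree numbering (I = {1..5}), with ch_3 = q h^3 + N' x for some
N'>0 and ch_p in Q h^p otherwise - door II' up to integer multiples, consumed by ScaledSeedBridge.
The exact-x version filed at birth is unsatisfiable for the standard Chern character (integrality of
ch), hence the repair; mathematical content unchanged. -/
@[route_item "route-HodgeConjecture-TensorMonadSeeds", crux]
def MonadToSemiregularSeed : Prop :=
  ∀ (C : Literature.AlgebraicGeometry.HodgeTheory.ChernCharacterBetti) (d : ℕ), 0 < d → ∀ (Y : Literature.AlgebraicGeometry.Motives.AbelianVariety ℂ) (Ψ : Y ⟶ Y), Y.dim = 2 * 3 → CategoryTheory.CategoryStruct.comp Ψ Ψ = -((d : ℤ) • CategoryTheory.CategoryStruct.id Y) → (∃ (A₁ : Literature.AlgebraicGeometry.Motives.AbelianVariety ℂ) (f₁ : Y ⟶ A₁.prod A₁) (g₁ : A₁.prod A₁ ⟶ Y) (m : ℕ), A₁.dim = 3 ∧ 0 < m ∧ CategoryTheory.CategoryStruct.comp f₁ g₁ = m • CategoryTheory.CategoryStruct.id Y ∧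 AlgebraicGeometry.Flat f₁.hom.hom.hom.left ∧ CategoryTheory.CategoryStruct.comp g₁ Ψ = CategoryTheory.CategoryStruct.comp (Literature.AlgebraicGeometry.Motives.AbelianVariety.prodLift (CategoryTheory.CategoryStruct.comp (Literature.AlgebraicGeometry.Motives.AbelianVariety.snd A₁ A₁) (-((d : ℤ) • CategoryTheory.CategoryStruct.id A₁))) (Literature.AlgebraicGeometry.Motives.AbelianVariety.fst A₁ A₁)) g₁) → ∀ (x : Literature.AlgebraicGeometry.HodgeTheory.complexBetti Y.X (2 * 3)), x ∈ Literature.AlgebraicGeometry.HodgeTheory.weilClassesOf Y Ψ 3 d → Literature.AlgebraicGeometry.HodgeTheory.IsRationalClass x → x ≠ 0 → ∀ (emb : Literature.AlgebraicGeometry.Motives.ProjectiveEmbedding Y.X) (a : Literature.AlgebraicGeometry.HodgeTheory.complexBetti (Literature.AlgebraicGeometry.Motives.projectiveSpace emb.n ℂ) 2), Literature.AlgebraicGeometry.HodgeTheory.IsRationalClass a → a ≠ 0 → ∀ (X₀ : Literature.AlgebraicGeometry.Motives.SchemeOver ℂ) (e : Y.X ≅ X₀), (∃ (N : ℕ) (E₀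 : X₀.left.Modules) (hE₀ : Literature.AlgebraicGeometry.Motives.IsFiniteLocallyFree E₀) (q : ℚ) (c : ℕ → ℚ), 0 < N ∧ Literature.AlgebraicGeometry.HodgeTheory.complexBetti.map e.hom (2 * 3) (C.ch X₀ E₀ 3) = ((q : ℚ) : ℂ) • Literature.AlgebraicGeometry.HodgeTheory.cupPowTwo (Literature.AlgebraicGeometry.HodgeTheory.complexBetti.map emb.ι 2 a) 3 + ((N : ℚ) : ℂ) • x ∧ (∀ p' ∈ ({1, 2, 3, 4, 5} : Finset ℕ), p' ≠ 3 → Literature.AlgebraicGeometry.HodgeTheory.complexBetti.map e.hom (2 * p') (C.ch X₀ E₀ p') = ((c p' : ℚ) : ℂ) • Literature.AlgebraicGeometry.HodgeTheory.cupPowTwo (Literature.AlgebraicGeometry.HodgeTheory.complexBetti.map emb.ι 2 a) p') ∧ ∃ (m₁ m₂ m₃ : ℕ) (L : Fin m₁ → X₀.left.Modules) (M : Fin m₂ → X₀.left.Modules) (N : Fin m₃ → X₀.left.Modules) (α : CategoryTheory.Limits.sigmaObj L ⟶ CategoryTheory.Limits.sigmaObj M) (β : CategoryTheory.Limits.sigmaObj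 M ⟶ CategoryTheory.Limits.sigmaObj N) (hαβ : CategoryTheory.CategoryStruct.comp α β = 0), (∀ i, Literature.AlgebraicGeometry.Motives.HasRank (L i) 1) ∧ (∀ i, Literature.AlgebraicGeometry.Motives.HasRank (M i) 1) ∧ (∀ i, Literature.AlgebraicGeometry.Motives.HasRank (N i) 1) ∧ CategoryTheory.Mono α ∧ CategoryTheory.Epi β ∧ Nonempty (E₀ ≅ CategoryTheory.Limits.cokernel (CategoryTheory.Limits.kernel.lift β α hαβ))) → ∃ (N : ℕ) (E₀ : X₀.left.Modules) (hE₀ : Literature.AlgebraicGeometry.Motives.IsFiniteLocallyFree E₀) (q : ℚ) (c : ℕ → ℚ), 0 < N ∧ 3 ∈ ({1, 2, 3, 4, 5} : Finset ℕ) ∧ Literature.AlgebraicGeometry.HodgeTheory.IsISemiregular hE₀ {q' | q' + 1 ∈ ({1, 2, 3, 4, 5} : Finset ℕ)} ∧ Literature.AlgebraicGeometry.HodgeTheory.complexBetti.map e.hom (2 * 3) (C.ch X₀ E₀ 3) = ((q : ℚ) : ℂ) • Literature.AlgebraicGeometry.HodgeTheory.cupPowTwo (Literature.AlgebraicGeometry.HodgeTheory.complexBetti.map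 emb.ι 2 a) 3 + ((N : ℚ) : ℂ) • x ∧ (∀ p' ∈ ({1, 2, 3, 4, 5} : Finset ℕ), p' ≠ 3 → Literature.AlgebraicGeometry.HodgeTheory.complexBetti.map e.hom (2 * p') (C.ch X₀ E₀ p') = ((c p' : ℚ) : ℂ) • Literature.AlgebraicGeometry.HodgeTheory.cupPowTwo (Literature.AlgebraicGeometry.HodgeTheory.complexBetti.map emb.ι 2 a) p')

-- earlier MonadClassDesigns (stmt-HodgeConjecture-25634, replaced 2026-08-28T07:01:11Z -> stmt-HodgeConjecture-26402): retired by None — ∀ (C : Literature.AlgebraicGeometry.HodgeTheory.ChernCharacterBetti) (d : ℕ), 0 < d → ∀ (Y : Literature.AlgebraicGeometry.Motives.AbelianVariety ℂ) (Ψ : Y ⟶ Y), Y.dim = 2 * 3 → CategoryTheory.CategoryStruct.comp Ψ Ψ = -((d : ℤ) • CategoryTheory.CategoryStruct.id Y)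
/-- item stmt-HodgeConjecture-26402 · crux · rank 3 · closed · moot by None · by planner
why it might fail: a ∀(Y,Ψ,h) claim sampled only at two tensor points and two polarization rays (TMS-(i)); some ample h on some tensor-type Y (NS rank 3, h far from the Ψ-compatible ray) may admit no honest three-band solution of the degree-1..5 moment equations in line-bundle classes
sources: BuchweitzFlenner2003:Thm5.1, lange1992-complex-abelian-varieties:p335, INSTRUMENT-RESULTS-TMS-i.md
[crux, REPAIRED 2026-08-28 by the route owner] K1 monad class designs UP TO A POSITIVE INTEGER
MULTIPLE: for every Chern character theory C, every d>0, every tensor-type Weil sixfold (Y,Psi),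
every non-zero rational Weil class x, every polarization instance a and model, there are N>0 and a
three-term monad of line-bundle sums whose cohomology E0 has ch_3 = q h^3 + N x and ch_p in Q h^p (p
= 1,2,4,5). The exact-x version filed at birth is false for the standard Chern character (ch_3 of a
locally free sheaf lies in (1/6)H^6(Y,Z), a lattice; x ranges over a Q-line), hence the integer
multiple; the TMS-(i) certificates (rational LP weights) witness exactly this scaled form at the
sampled points. -/
@[route_item "route-HodgeConjecture-TensorMonadSeeds", crux]
def MonadClassDesigns : Prop :=
  ∀ (C : Literature.AlgebraicGeometry.HodgeTheory.ChernCharacterBetti) (d : ℕ), 0 < d → ∀ (Y : Literature.AlgebraicGeometry.Motives.AbelianVariety ℂ) (Ψ : Y ⟶ Y), Y.dim = 2 * 3 → CategoryTheory.CategoryStruct.comp Ψ Ψ = -((d : ℤ) • CategoryTheory.CategoryStruct.id Y) → (∃ (A₁ : Literature.AlgebraicGeometry.Motives.AbelianVariety ℂ) (f₁ : Y ⟶ A₁.prod A₁) (g₁ : A₁.prod A₁ ⟶ Y) (m : ℕ), A₁.dim = 3 ∧ 0 < m ∧ CategoryTheory.CategoryStruct.comp f₁ g₁ = m • CategoryTheory.CategoryStruct.id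 Y ∧ AlgebraicGeometry.Flat f₁.hom.hom.hom.left ∧ CategoryTheory.CategoryStruct.comp g₁ Ψ = CategoryTheory.CategoryStruct.comp (Literature.AlgebraicGeometry.Motives.AbelianVariety.prodLift (CategoryTheory.CategoryStruct.comp (Literature.AlgebraicGeometry.Motives.AbelianVariety.snd A₁ A₁) (-((d : ℤ) • CategoryTheory.CategoryStruct.id A₁))) (Literature.AlgebraicGeometry.Motives.AbelianVariety.fst A₁ A₁)) g₁) → ∀ (x : Literature.AlgebraicGeometry.HodgeTheory.complexBetti Y.X (2 * 3)), x ∈ Literature.AlgebraicGeometry.HodgeTheory.weilClassesOf Y Ψ 3 d → Literature.AlgebraicGeometry.HodgeTheory.IsRationalClass x → x ≠ 0 → ∀ (emb : Literature.AlgebraicGeometry.Motives.ProjectiveEmbedding Y.X) (a : Literature.AlgebraicGeometry.HodgeTheory.complexBetti (Literature.AlgebraicGeometry.Motives.projectiveSpace emb.n ℂ) 2), Literature.AlgebraicGeometry.HodgeTheory.IsRationalClass a → a ≠ 0 → ∀ (X₀ : Literature.AlgebraicGeometry.Motives.SchemeOver ℂ) (e : Y.X ≅ X₀), ∃ (N :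 ℕ) (E₀ : X₀.left.Modules) (hE₀ : Literature.AlgebraicGeometry.Motives.IsFiniteLocallyFree E₀) (q : ℚ) (c : ℕ → ℚ), 0 < N ∧ Literature.AlgebraicGeometry.HodgeTheory.complexBetti.map e.hom (2 * 3) (C.ch X₀ E₀ 3) = ((q : ℚ) : ℂ) • Literature.AlgebraicGeometry.HodgeTheory.cupPowTwo (Literature.AlgebraicGeometry.HodgeTheory.complexBetti.map emb.ι 2 a) 3 + ((N : ℚ) : ℂ) • x ∧ (∀ p' ∈ ({1, 2, 3, 4, 5} : Finset ℕ), p' ≠ 3 → Literature.AlgebraicGeometry.HodgeTheory.complexBetti.map e.hom (2 * p') (C.ch X₀ E₀ p') = ((c p' : ℚ) : ℂ) • Literature.AlgebraicGeometry.HodgeTheory.cupPowTwo (Literature.AlgebraicGeometry.HodgeTheory.complexBetti.map emb.ι 2 a) p') ∧ ∃ (m₁ m₂ m₃ : ℕ) (L : Fin m₁ → X₀.left.Modules) (M : Fin m₂ → X₀.left.Modules) (N : Fin m₃ → X₀.left.Modules) (α : CategoryTheory.Limits.sigmaObj L ⟶ CategoryTheory.Limits.sigmaObj M) (β : CategoryTheory.Limits.sigmaObj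 M ⟶ CategoryTheory.Limits.sigmaObj N) (hαβ : CategoryTheory.CategoryStruct.comp α β = 0), (∀ i, Literature.AlgebraicGeometry.Motives.HasRank (L i) 1) ∧ (∀ i, Literature.AlgebraicGeometry.Motives.HasRank (M i) 1) ∧ (∀ i, Literature.AlgebraicGeometry.Motives.HasRank (N i) 1) ∧ CategoryTheory.Mono α ∧ CategoryTheory.Epi β ∧ Nonempty (E₀ ≅ CategoryTheory.Limits.cokernel (CategoryTheory.Limits.kernel.lift β α hαβ))

/-- item stmt-HodgeConjecture-19780 · crux · rank 5 · open · by planner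
why it might fail: only if the tree's `ChernCharacterBetti` structure over-axiomatises ch (an axiom false for the genuine Chern character); the genuine construction (GRR on Betti cohomology) is textbook.
sources: Fulton1984, VoisinHodgeI2002
[crux] K-C (construction): a Chern character theory on complex Betti cohomology satisfying Fulton's
laws exists — an instance of hsemireg's structure `ChernCharacterBetti` (intended: cl ∘ ch).
Load-bearing because the sheaf door and K-SR♭∃ are parametrised by C; the tree deliberately has no
existence theorem for the structure. [difficulty: L] -/
@[route_item "route-HodgeConjecture-TensorMonadSeeds", crux]
def ChernCharacterOnBetti : Prop :=
  Summit.HodgeConjecture.HodgeConjecture.Ring2.SemiregularRepresentatives.ChernCharacterOnBetti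

/-- item stmt-HodgeConjecture-25635 · crux · rank 6 · open · by planner
why it might fail: it is a published theorem (Compositio 137 (2003) Thm 5.1); only a mis-rendering of its hypotheses in the tree's statement could fail.
sources: arXiv:math/9912245
[crux] REFEREED NAMED FACT — Literature input, never staffed (only crux items may be binders of the
deciding theorem): Buchweitz–Flenner 2003 Thm 5.1 for I-semiregular sheaves, as typed in the tree
(`BuchweitzFlenner2003_variationalHodge_ISemiregular`). [difficulty: L] -/
@[route_item "route-HodgeConjecture-TensorMonadSeeds", crux]
def BFVariationalHodge : Prop :=
  Literature.AlgebraicGeometry.HodgeTheory.BuchweitzFlenner2003_variationalHodge_ISemiregular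

/-- item stmt-HodgeConjecture-25636 · crux · rank 7 · closed · moot by None · by planner
why it might fail: it is Deligne 1982 (LNM 900, proof of Thm 4.8 (a)–(c)) for every d; only a mis-rendering in the tree's statement could fail.
sources: Deligne1982HodgeCycles
[crux] REFEREED NAMED FACT — Literature input, never staffed: Deligne's √−d Weil families through
every Weil abelian 2k-fold with a flat global section of Weil classes and the tensor points in every
component, every d (`deligne1982_weilFamily_hodgeWeilSection_all`). [difficulty: L] -/
@[route_item "route-HodgeConjecture-TensorMonadSeeds", crux]
def DeligneWeilFamilies : Prop :=
  Literature.AlgebraicGeometry.HodgeTheory.deligne1982_weilFamily_hodgeWeilSection_all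

/-- item stmt-HodgeConjecture-26387 · support · rank 9 · closed · moot by None · by planner
[support] SCALED-SEED BRIDGE (door II' up to positive integer multiples => the local tensor clause):
for every Chern character theory C and d > 0, Buchweitz-Flenner's variational Hodge theorem for
I-semiregular sheaves plus, at every tensor point (Y,Psi) of discriminant d, for every non-zero
rational Weil class x, polarization instance a and model, SOME N > 0 and a finite locally free
{0..4}-semiregular E0 with ch_3 = q h^3 + N x, ch_p in Q h^p (p = 1,2,4,5), imply
HasLocallyAlgebraicTensorAnchors 3 d. Proof route: adapt
Literature/AlgebraicGeometry/HodgeTheory/WeilClassesBFSheafSeed.lean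
hasLocallyAlgebraicTensorAnchors_of_BF_of_tensorBFSheafSeeds pointwise with W := N W (still
fibrewise rational of Hodge type) and divide by N in algebraicClasses (a C-submodule). Needed
because the exact-x door is unsatisfiable for the standard Chern character (ch_3 of a locally free
sheaf lies in (1/6)H^6(Y,Z)). Difficulty M; sources BuchweitzFlenner2003 Thm 5.1, VoisinHodgeII2003
Cor 1.24. -/
@[route_item "route-HodgeConjecture-TensorMonadSeeds", crux]
def ScaledSeedBridge : Prop :=
  ∀ (C : Literature.AlgebraicGeometry.HodgeTheory.ChernCharacterBetti) (d : ℕ), 0 < d → Literature.AlgebraicGeometry.HodgeTheory.BuchweitzFlenner2003_variationalHodge_ISemiregular → (∀ (Y : Literature.AlgebraicGeometry.Motives.AbelianVariety ℂ) (Ψ : Y ⟶ Y), Y.dim = 2 * 3 → CategoryTheory.CategoryStruct.comp Ψ Ψ = -((d : ℤ) • CategoryTheory.CategoryStruct.id Y) → (∃ (A₁ : Literature.AlgebraicGeometry.Motives.AbelianVariety ℂ) (f₁ : Y ⟶ A₁.prod A₁) (g₁ : A₁.prod A₁ ⟶ Y) (m : ℕ), A₁.dim = 3 ∧ 0 < m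 ∧ CategoryTheory.CategoryStruct.comp f₁ g₁ = m • CategoryTheory.CategoryStruct.id Y ∧ AlgebraicGeometry.Flat f₁.hom.hom.hom.left ∧ CategoryTheory.CategoryStruct.comp g₁ Ψ = CategoryTheory.CategoryStruct.comp (Literature.AlgebraicGeometry.Motives.AbelianVariety.prodLift (CategoryTheory.CategoryStruct.comp (Literature.AlgebraicGeometry.Motives.AbelianVariety.snd A₁ A₁) (-((d : ℤ) • CategoryTheory.CategoryStruct.id A₁))) (Literature.AlgebraicGeometry.Motives.AbelianVariety.fst A₁ A₁)) g₁) → ∀ (x : Literature.AlgebraicGeometry.HodgeTheory.complexBetti Y.X (2 * 3)), x ∈ Literature.AlgebraicGeometry.HodgeTheory.weilClassesOf Y Ψ 3 d → Literature.AlgebraicGeometry.HodgeTheory.IsRationalClass x → x ≠ 0 → ∀ (emb : Literature.AlgebraicGeometry.Motives.ProjectiveEmbedding Y.X) (a : Literature.AlgebraicGeometry.HodgeTheory.complexBetti (Literature.AlgebraicGeometry.Motives.projectiveSpace emb.n ℂ) 2), Literature.AlgebraicGeometry.HodgeTheory.IsRationalClass a → a ≠ 0 → ∀ (X₀ : Literature.AlgebraicGeometry.Motives.SchemeOver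 ℂ) (e : Y.X ≅ X₀), ∃ (N : ℕ) (E₀ : X₀.left.Modules) (hE₀ : Literature.AlgebraicGeometry.Motives.IsFiniteLocallyFree E₀) (q : ℚ) (c : ℕ → ℚ), 0 < N ∧ 3 ∈ ({1, 2, 3, 4, 5} : Finset ℕ) ∧ Literature.AlgebraicGeometry.HodgeTheory.IsISemiregular hE₀ {q' | q' + 1 ∈ ({1, 2, 3, 4, 5} : Finset ℕ)} ∧ Literature.AlgebraicGeometry.HodgeTheory.complexBetti.map e.hom (2 * 3) (C.ch X₀ E₀ 3) = ((q : ℚ) : ℂ) • Literature.AlgebraicGeometry.HodgeTheory.cupPowTwo (Literature.AlgebraicGeometry.HodgeTheory.complexBetti.map emb.ι 2 a) 3 + ((N : ℚ) : ℂ) • x ∧ (∀ p' ∈ ({1, 2, 3, 4, 5} : Finset ℕ), p' ≠ 3 → Literature.AlgebraicGeometry.HodgeTheory.complexBetti.map e.hom (2 * p') (C.ch X₀ E₀ p') = ((c p' : ℚ) : ℂ) • Literature.AlgebraicGeometry.HodgeTheory.cupPowTwo (Literature.AlgebraicGeometry.HodgeTheory.complexBetti.map emb.ι 2 a) p')) →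 Literature.AlgebraicGeometry.HodgeTheory.HasLocallyAlgebraicTensorAnchors 3 d

-- earlier Assembly (stmt-HodgeConjecture-25637, replaced 2026-08-28T07:01:11Z -> stmt-HodgeConjecture-26404): retired by None — ChernCharacterOnBetti → BFVariationalHodge → DeligneWeilFamilies → MonadClassDesigns → MonadToSemiregularSeed → Summit.HodgeConjecture.HodgeConjecture.Theses.SevenfoldWeilCensus.WeilSixfolds
/-- item stmt-HodgeConjecture-26404 · assembly · rank 1 · closed · moot by None · by planner
sources: arXiv:math/9912245, Deligne1982HodgeCycles
[assembly] ChernCharacterOnBetti → BFVariationalHodge → DeligneWeilFamilies → ScaledSeedBridge →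
MonadClassDesigns → MonadToSemiregularSeed → WeilSixfolds (repaired 2026-08-28: scaled-seed bridge
added). -/
@[route_item "route-HodgeConjecture-TensorMonadSeeds"]
def Assembly : Prop :=
  ChernCharacterOnBetti → BFVariationalHodge → DeligneWeilFamilies → ScaledSeedBridge → MonadClassDesigns → MonadToSemiregularSeed → Summit.HodgeConjecture.HodgeConjecture.Theses.SevenfoldWeilCensus.WeilSixfolds

/-! D-0027 §2.1 — DECIDING THEOREM (planner-authored via `route open/edit --closes-file`; by planner-hodge-idea-3-g0-0 2026-08-28T07:01:11Z) — ARCHIVED: route closed (retired) 2026-08-28T12:06:36Z; kept so importers keep building: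
its hypotheses are this route's items and its conclusion the registered leaf `Summit.HodgeConjecture.HodgeConjecture.Theses.SevenfoldWeilCensus.WeilSixfolds` (rung H2, D-0061) (glue_lint), and it elaborates with this file. -/

@[closes "route-HodgeConjecture-TensorMonadSeeds"] theorem closes (hC : ChernCharacterOnBetti) (hBF : BFVariationalHodge) (hD : DeligneWeilFamilies)
    (hS : ScaledSeedBridge) (k1 : MonadClassDesigns) (k2 : MonadToSemiregularSeed) :
    Summit.HodgeConjecture.HodgeConjecture.Theses.SevenfoldWeilCensus.WeilSixfolds := by
  obtain ⟨C⟩ := hC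
  refine Summit.HodgeConjecture.HodgeConjecture.WeilTypeLadder.weilSixfolds_of_deligneAll_of_tensorLocalAnchors
    hD fun d hd => ?_
  refine hS C d hd hBF ?_
  intro Y Ψ hY hΨ hpt x hxW hxr hx0 emb a ha ha0 X₀ e
  exact k2 C d hd Y Ψ hY hΨ hpt x hxW hxr hx0 emb a ha ha0 X₀ e
    (k1 C d hd Y Ψ hY hΨ hpt x hxW hxr hx0 emb a ha ha0 X₀ e)

end Summit.HodgeConjecture.HodgeConjecture.Theses.TensorMonadSeeds
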